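import Literature.NumberTheory.Sieve.BombieriFriedlanderIwaniecDispersionMainTerm
import HarnessLib

/-!
# Bombieri–Friedlander–Iwaniec 1986, Theorem 1: the main-term error `𝒳 − X` (7.1), averaged

Topic `Literature/NumberTheory/Sieve`.  Part of the assembly of the proof of Theorem 1 of
E. Bombieri, J. B. Friedlander, H. Iwaniec, *Primes in arithmetic progressions to large moduli*,
Acta Math. 156 (1986), 203–251.  The file `…DispersionMainTerm` proves (§7, (7.1)–(7.5))
`|𝒳 − X| ≤ ∑_{r∼R} ∑_{q₁,q₂∼Q} xErr` with an explicit summand `BFI.xErr` made of (for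
`q₀ = (q₁,q₂) ≤ Q₀`) the Barban–Davenport–Halberstam cross terms `|γγ|/L · (D(q₁';q₀r)+D(q₂';q₀r))/2`
and the pairs with a common factor `|γγ|/L · log₂(2N)(2N/(zq₀r)+1)‖β‖²`, and (for `q₀ > Q₀`) the
trivial bound `|γγ|(∑|β|)²/(Lφ(q₀r))`.  Here this is AVERAGED over the moduli with the weights
`|γ_q| ≤ τ(q)^B` of (A₃) — the step "(7.1) … rests on Theorem 0" of p. 222 — keeping only
LOGARITHMIC losses, since the saving available in (7.1) is `ℒ^{−A}` and no more:

* `BFI.abs_calX_sub_mainX_le_avg`: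
  `|𝒳 − X| ≤ W₀ S_b S_{3b+1}/R + log₂(2N) ‖β‖² (8N/(zR) + 4Q₀) S_b² + 3N‖β‖² S₁ S_b S_{2b+2}/(R Q₀)`,
  where `b = ⌈B⌉`, `S_k` bounds `∑_{n ≤ 2Q} τ(n)^k/n` (`S₁`: `∑_{n≤2R} τ(n)/n`) and `W₀ τ(d)^B` bounds
  the Barban–Davenport–Halberstam sums `∑_{q ≤ 2Q₀R} D(d; q)` (hypothesis `h0a`, discharged in the
  assembly by the PROVED `BombieriFriedlanderIwaniecTheorem0a`, with `W₀ = C‖β‖²N(log N)^{−A'}`).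

The divisor sums `S_k ≪ (log)^{2^{k+1}}` come from `DivisorPowerSums` in the assembly; the greatest
common divisor `q₀` is handled by the majorisation `∑_{q₁,q₂} F(q₀) ≤ ∑_{q₁} ∑_{g∣q₁} ∑_{g∣q₂} F(g)`
(all terms being `≥ 0`).  Everything here is PROVED; no named facts are introduced.

## References

* E. Bombieri, J. B. Friedlander, H. Iwaniec, Acta Math. 156 (1986), 203–251, §7 (7.1)–(7.5)
  pp. 222–223; §6 (6.3) p. 220. [BombieriFriedlanderIwaniecActa1986]
-/

noncomputable section

open Finset Real
open scoped ArithmeticFunction.sigma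

namespace Literature.NumberTheory.Sieve

namespace BFI

/-! ### Divisor-weight tools with natural exponents -/

/-- `τ(q)^B ≤ τ(q)^b` for `B ≤ b`, `q ≥ 1`. [folklore] -/
theorem sigma_rpow_le_pow {B : ℝ} {b : ℕ} (hb : B ≤ b) {q : ℕ} (hq : 0 < q) :
    (σ 0 q : ℝ) ^ B ≤ (σ 0 q : ℝ) ^ b := by
  have h1 : (1 : ℝ) ≤ (σ 0 q : ℝ) := by exact_mod_cast one_le_sigma_zero hq.ne'
  calc (σ 0 q : ℝ) ^ B ≤ (σ 0 q : ℝ) ^ (b : ℝ) := Real.rpow_le_rpow_of_exponent_le h1 hb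
    _ = (σ 0 q : ℝ) ^ b := Real.rpow_natCast _ _

/-- `|γ_q| ≤ τ(q)^B ≤ τ(q)^b` for `B ≤ b` (`q ≥ 1`). [folklore] -/
theorem abs_le_sigma_pow_of_rpow {γ : ℕ → ℝ} {B : ℝ} (hγ : ∀ q, |γ q| ≤ (σ 0 q : ℝ) ^ B)
    {b : ℕ} (hb : B ≤ b) {q : ℕ} (hq : 0 < q) : |γ q| ≤ (σ 0 q : ℝ) ^ b :=
  (hγ q).trans (sigma_rpow_le_pow hb hq)

/-- `τ(gm)^k ≤ τ(g)^k τ(m)^k`. [folklore] -/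
theorem sigma_mul_pow_le (g m k : ℕ) :
    (σ 0 (g * m) : ℝ) ^ k ≤ (σ 0 g : ℝ) ^ k * (σ 0 m : ℝ) ^ k := by
  rw [← mul_pow]
  exact pow_le_pow_left₀ (by positivity) (by exact_mod_cast sigma_zero_mul_le g m) k

/-- **Multiples of `g` in a dyadic range**: for `g ≥ 1`, `Q ≥ 0` and `k ≥ 0`,
`∑_{q ∼ Q, g ∣ q} τ(q)^k/q ≤ (τ(g)^k/g) ∑_{m ≤ 2Q} τ(m)^k/m` (`q = gm`, `τ(gm) ≤ τ(g)τ(m)`). [folklore] -/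
theorem sum_dyadic_filter_dvd_le {g : ℕ} (hg : 0 < g) {Q : ℝ} (hQ : 0 ≤ Q) (k : ℕ) :
    ∑ q ∈ (dyadic Q).filter (fun q => g ∣ q), (σ 0 q : ℝ) ^ k / q ≤
      (σ 0 g : ℝ) ^ k / g * ∑ m ∈ Icc 1 ⌊2 * Q⌋₊, (σ 0 m : ℝ) ^ k / m := by
  set F := (dyadic Q).filter (fun q => g ∣ q) with hF
  set h : ℕ → ℝ := fun m => (σ 0 m : ℝ) ^ k / m with hh
  have hinj : ∀ x ∈ F, ∀ y ∈ F, x / g = y / g → x = y := by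
    intro x hx y hy hxy
    rw [hF, Finset.mem_filter] at hx hy
    rw [← Nat.div_mul_cancel hx.2, ← Nat.div_mul_cancel hy.2, hxy]
  have himg : F.image (fun q => q / g) ⊆ Icc 1 ⌊2 * Q⌋₊ := by
    intro m hm
    rw [Finset.mem_image] at hm
    obtain ⟨q, hq, rfl⟩ := hm
    rw [hF, Finset.mem_filter] at hq
    have hq' := dyadic_subset_Icc hQ hq.1
    rw [Finset.mem_Icc] at hq' ⊢
    exact ⟨Nat.div_pos (Nat.le_of_dvd (by omega) hq.2) hg, (Nat.div_le_self q g).trans hq'.2⟩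
  have hterm : ∀ q ∈ F, (σ 0 q : ℝ) ^ k / q ≤ (σ 0 g : ℝ) ^ k / g * h (q / g) := by
    intro q hq
    rw [hF, Finset.mem_filter] at hq
    obtain ⟨m, rfl⟩ := hq.2
    have hq0 : 0 < g * m := pos_of_mem_dyadic hQ hq.1
    have hm0 : 0 < m := Nat.pos_of_ne_zero fun h0 => by simp [h0] at hq0
    rw [hh, Nat.mul_div_cancel_left m hg]
    have hg0 : (0 : ℝ) < g := by exact_mod_cast hg
    have hm0' : (0 : ℝ) < m := by exact_mod_cast hm0
    simp only [Nat.cast_mul]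
    rw [div_mul_div_comm, div_le_div_iff_of_pos_right (by positivity)]
    exact sigma_mul_pow_le g m k
  calc ∑ q ∈ F, (σ 0 q : ℝ) ^ k / q ≤ ∑ q ∈ F, (σ 0 g : ℝ) ^ k / g * h (q / g) :=
        Finset.sum_le_sum hterm
    _ = (σ 0 g : ℝ) ^ k / g * ∑ m ∈ F.image (fun q => q / g), h m := by
        rw [Finset.mul_sum, Finset.sum_image hinj]
    _ ≤ (σ 0 g : ℝ) ^ k / g * ∑ m ∈ Icc 1 ⌊2 * Q⌋₊, h m := by
        refine mul_le_mul_of_nonneg_left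
          (Finset.sum_le_sum_of_subset_of_nonneg himg fun m _ _ => by positivity) (by positivity)

/-- The unrestricted case `g = 1`: `∑_{q∼Q} τ(q)^k/q ≤ ∑_{m ≤ 2Q} τ(m)^k/m`. [folklore] -/
theorem sum_dyadic_sigma_pow_div_le_Icc {Q : ℝ} (hQ : 0 ≤ Q) (k : ℕ) :
    ∑ q ∈ dyadic Q, (σ 0 q : ℝ) ^ k / q ≤ ∑ m ∈ Icc 1 ⌊2 * Q⌋₊, (σ 0 m : ℝ) ^ k / m := by
  have h := sum_dyadic_filter_dvd_le Nat.one_pos hQ k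
  rw [Finset.filter_true_of_mem (fun q _ => one_dvd q)] at h
  simpa [ArithmeticFunction.sigma_zero_apply] using h

/-- `∑_{g ∣ q, P g} τ(g)^k ≤ τ(q)^{k+1}` (each `τ(g) ≤ τ(q)`, at most `τ(q)` divisors). [folklore] -/
theorem sum_divisors_filter_sigma_pow_le {q : ℕ} (hq : 0 < q) (P : ℕ → Prop) [DecidablePred P]
    (k : ℕ) : ∑ g ∈ q.divisors.filter P, (σ 0 g : ℝ) ^ k ≤ (σ 0 q : ℝ) ^ (k + 1) := by
  calc ∑ g ∈ q.divisors.filter P, (σ 0 g : ℝ) ^ k ≤ ∑ g ∈ q.divisors, (σ 0 g : ℝ) ^ k :=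
        Finset.sum_le_sum_of_subset_of_nonneg (Finset.filter_subset _ _) fun g _ _ => by positivity
    _ ≤ ∑ g ∈ q.divisors, (σ 0 q : ℝ) ^ k := by
        refine Finset.sum_le_sum fun g hg => pow_le_pow_left₀ (by positivity) ?_ k
        exact_mod_cast sigma_zero_le_of_dvd hq.ne' (Nat.dvd_of_mem_divisors hg)
    _ = (σ 0 q : ℝ) ^ (k + 1) := by
        rw [Finset.sum_const, nsmul_eq_mul, ← ArithmeticFunction.sigma_zero_apply, pow_succ,
          mul_comm]

/-- **Majorisation by the divisors of `q₁`**: for nonnegative `F`,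
`∑_{q₂∼Q, P(q₀)} F((q₁,q₂), q₂) ≤ ∑_{g ∣ q₁, P g} ∑_{q₂∼Q, g ∣ q₂} F(g, q₂)` (`q₁ ≥ 1`): the term of
`q₂` on the left is the term `g = (q₁,q₂)` on the right. [folklore] -/
theorem sum_gcd_le_sum_divisors {q₁ : ℕ} (hq₁ : 0 < q₁) (Q : ℝ) (P : ℕ → Prop) [DecidablePred P]
    {F : ℕ → ℕ → ℝ} (hF : ∀ g q₂, 0 ≤ F g q₂) :
    ∑ q₂ ∈ dyadic Q, (if P (Nat.gcd q₁ q₂) then F (Nat.gcd q₁ q₂) q₂ else 0) ≤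
      ∑ g ∈ q₁.divisors.filter P, ∑ q₂ ∈ (dyadic Q).filter (fun q₂ => g ∣ q₂), F g q₂ := by
  rw [Finset.sum_comm' (t' := dyadic Q)
    (s' := fun q₂ => (q₁.divisors.filter P).filter (fun g => g ∣ q₂))
    (h := fun g q₂ => by
      simp only [Finset.mem_filter]
      tauto)]
  refine Finset.sum_le_sum fun q₂ _ => ?_
  split_ifs with hP
  · have hmem : Nat.gcd q₁ q₂ ∈ (q₁.divisors.filter P).filter (fun g => g ∣ q₂) := by
      simp only [Finset.mem_filter, Nat.mem_divisors]
      exact ⟨⟨⟨Nat.gcd_dvd_left q₁ q₂, hq₁.ne'⟩, hP⟩, Nat.gcd_dvd_right q₁ q₂⟩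
    exact Finset.single_le_sum (fun g _ => hF g q₂) hmem
  · exact Finset.sum_nonneg fun g _ => hF g q₂

/-- `∑_{r∼R} f(g r) ≤ ∑_{q ≤ 2Q₀R} f(q)` for `f ≥ 0`, `1 ≤ g ≤ Q₀` (the map `r ↦ gr` is injective and
lands in `[1, 2Q₀R]`). [folklore] -/
theorem sum_dyadic_comp_mul_le {f : ℕ → ℝ} (hf : ∀ q, 0 ≤ f q) {g : ℕ} (hg : 0 < g) {Q₀ R : ℝ}
    (hgQ : (g : ℝ) ≤ Q₀) (hR : 0 ≤ R) :
    ∑ r ∈ dyadic R, f (g * r) ≤ ∑ q ∈ Icc 1 ⌊2 * Q₀ * R⌋₊, f q := by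
  have hinj : ∀ x ∈ dyadic R, ∀ y ∈ dyadic R, g * x = g * y → x = y :=
    fun x _ y _ h => Nat.eq_of_mul_eq_mul_left hg h
  rw [← Finset.sum_image hinj]
  refine Finset.sum_le_sum_of_subset_of_nonneg ?_ fun q _ _ => hf q
  intro q hq
  rw [Finset.mem_image] at hq
  obtain ⟨r, hr, rfl⟩ := hq
  have hr' := (mem_dyadic hR).1 hr
  have hr0 := pos_of_mem_dyadic hR hr
  rw [Finset.mem_Icc]
  refine ⟨Nat.mul_pos hg hr0, Nat.le_floor ?_⟩
  push_cast
  calc (g : ℝ) * r ≤ Q₀ * (2 * R) := mul_le_mul hgQ hr'.2 (by positivity) (by linarith)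
    _ = 2 * Q₀ * R := by ring

/-! ### The three pieces of `xErr`, bounded termwise -/

/-- `1/L = q₀/(q₁q₂r)` (`L = [q₁,q₂]r`, `q₀ = (q₁,q₂)`), for `r, q₁, q₂ ≥ 1`. [folklore] -/
theorem inv_lmod_eq {r q₁ q₂ : ℕ} (hr : 0 < r) (hq₁ : 0 < q₁) (hq₂ : 0 < q₂) :
    ((lmod r q₁ q₂ : ℕ) : ℝ)⁻¹ = (Nat.gcd q₁ q₂ : ℝ) / ((q₁ : ℝ) * q₂ * r) := by
  have hL := lmod_pos hr hq₁ hq₂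
  have hg : 0 < Nat.gcd q₁ q₂ := Nat.gcd_pos_of_pos_left _ hq₁
  have e : ((lmod r q₁ q₂ : ℕ) : ℝ) * (Nat.gcd q₁ q₂ : ℝ) = (q₁ : ℝ) * q₂ * r := by
    exact_mod_cast lmod_mul_gcd r q₁ q₂
  have hL0 : (0 : ℝ) < (lmod r q₁ q₂ : ℕ) := by exact_mod_cast hL
  have hg0 : (0 : ℝ) < (Nat.gcd q₁ q₂ : ℕ) := by exact_mod_cast hg
  rw [eq_div_iff (by positivity), ← e]
  field_simp

/-- Piece 1 of `xErr` (`q₀ ≤ Q₀`, the Barban–Davenport–Halberstam cross term): for `r ≥ R > 0`,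
`|γ₁γ₂|/L · (D₁+D₂)/2 ≤ τ(q₁)^bτ(q₂)^b (q₀/(q₁q₂)) (2R)⁻¹ (D₁ + D₂)`. [folklore] -/
theorem xErr_piece1_le {R B : ℝ} (hR : 0 < R) {b : ℕ} (hb : B ≤ b) {γ : ℕ → ℝ}
    (hγ : ∀ q, |γ q| ≤ (σ 0 q : ℝ) ^ B) {r q₁ q₂ : ℕ} (hr : 0 < r) (hq₁ : 0 < q₁) (hq₂ : 0 < q₂)
    (hRr : R ≤ r) {D : ℝ} (hD : 0 ≤ D) :
    |γ q₁| * |γ q₂| / ((lmod r q₁ q₂ : ℕ) : ℝ) * (D / 2) ≤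
      (σ 0 q₁ : ℝ) ^ b * (σ 0 q₂ : ℝ) ^ b * ((Nat.gcd q₁ q₂ : ℝ) / ((q₁ : ℝ) * q₂)) *
        (2 * R)⁻¹ * D := by
  have hr0 : (0 : ℝ) < r := by exact_mod_cast hr
  have hq₁0 : (0 : ℝ) < q₁ := by exact_mod_cast hq₁
  have hq₂0 : (0 : ℝ) < q₂ := by exact_mod_cast hq₂
  have hγ₁ := abs_le_sigma_pow_of_rpow hγ hb hq₁
  have hγ₂ := abs_le_sigma_pow_of_rpow hγ hb hq₂
  rw [div_eq_mul_inv (|γ q₁| * |γ q₂|), inv_lmod_eq hr hq₁ hq₂]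
  have e : |γ q₁| * |γ q₂| * ((Nat.gcd q₁ q₂ : ℝ) / ((q₁ : ℝ) * q₂ * r)) * (D / 2) =
      |γ q₁| * |γ q₂| * ((Nat.gcd q₁ q₂ : ℝ) / ((q₁ : ℝ) * q₂)) * (2 * (r : ℝ))⁻¹ * D := by
    field_simp
  rw [e]
  have hinv : (2 * (r : ℝ))⁻¹ ≤ (2 * R)⁻¹ := by
    rw [inv_le_inv₀ (by positivity) (by positivity)]; linarith
  gcongr

/-- Piece 2 of `xErr` (`q₀ ≤ Q₀`, the pairs with a common factor): for `r ≥ R > 0`, `z > 0`,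
`|γ₁γ₂|/L · log₂(2N)(2N/(zq₀r)+1)‖β‖² ≤ τ(q₁)^bτ(q₂)^b log₂(2N) ‖β‖² (2N/(zR) + Q₀)/(q₁q₂r)`.
[folklore] -/
theorem xErr_piece2_le {N Q₀ z R B : ℝ} (hN : 0 ≤ N) (hz : 0 < z) (hR : 0 < R) {b : ℕ}
    (hb : B ≤ b) {γ : ℕ → ℝ} (hγ : ∀ q, |γ q| ≤ (σ 0 q : ℝ) ^ B) (β : ℕ → ℝ) {r q₁ q₂ : ℕ}
    (hr : 0 < r) (hq₁ : 0 < q₁) (hq₂ : 0 < q₂) (hRr : R ≤ r) (hgQ : (Nat.gcd q₁ q₂ : ℝ) ≤ Q₀) :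
    |γ q₁| * |γ q₂| / ((lmod r q₁ q₂ : ℕ) : ℝ) *
        ((Nat.log 2 ⌊2 * N⌋₊ : ℝ) * (2 * N / (z * (gmod r q₁ q₂ : ℝ)) + 1) * l2Sq N β) ≤
      (σ 0 q₁ : ℝ) ^ b * (σ 0 q₂ : ℝ) ^ b * ((Nat.log 2 ⌊2 * N⌋₊ : ℝ) * l2Sq N β *
        (2 * N / (z * R) + Q₀)) / ((q₁ : ℝ) * q₂ * r) := by
  have hg : 0 < Nat.gcd q₁ q₂ := Nat.gcd_pos_of_pos_left _ hq₁
  have hg0 : (0 : ℝ) < (Nat.gcd q₁ q₂ : ℝ) := by exact_mod_cast hg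
  have hr0 : (0 : ℝ) < r := by exact_mod_cast hr
  have hq₁0 : (0 : ℝ) < q₁ := by exact_mod_cast hq₁
  have hq₂0 : (0 : ℝ) < q₂ := by exact_mod_cast hq₂
  have hγ₁ := abs_le_sigma_pow_of_rpow hγ hb hq₁
  have hγ₂ := abs_le_sigma_pow_of_rpow hγ hb hq₂
  have hl := l2Sq_nonneg N β
  have hlog : (0 : ℝ) ≤ (Nat.log 2 ⌊2 * N⌋₊ : ℝ) := Nat.cast_nonneg _
  have hGm : ((gmod r q₁ q₂ : ℕ) : ℝ) = (Nat.gcd q₁ q₂ : ℝ) * r := by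
    simp only [gmod, Nat.cast_mul]
  rw [div_eq_mul_inv (|γ q₁| * |γ q₂|), inv_lmod_eq hr hq₁ hq₂, hGm]
  -- the key inequality for the bracket
  have key : (Nat.gcd q₁ q₂ : ℝ) / ((q₁ : ℝ) * q₂ * r) *
      (2 * N / (z * ((Nat.gcd q₁ q₂ : ℝ) * r)) + 1) ≤
      (2 * N / (z * R) + Q₀) / ((q₁ : ℝ) * q₂ * r) := by
    have e1 : (Nat.gcd q₁ q₂ : ℝ) / ((q₁ : ℝ) * q₂ * r) *
        (2 * N / (z * ((Nat.gcd q₁ q₂ : ℝ) * r)) + 1) =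
        (2 * N / z * (r : ℝ)⁻¹ + (Nat.gcd q₁ q₂ : ℝ)) / ((q₁ : ℝ) * q₂ * r) := by
      field_simp
    have e2 : (2 * N / (z * R) + Q₀) / ((q₁ : ℝ) * q₂ * r) =
        (2 * N / z * R⁻¹ + Q₀) / ((q₁ : ℝ) * q₂ * r) := by
      field_simp
    rw [e1, e2]
    have hinv : (r : ℝ)⁻¹ ≤ R⁻¹ := by rw [inv_le_inv₀ hr0 hR]; exact hRr
    gcongr
  calc |γ q₁| * |γ q₂| * ((Nat.gcd q₁ q₂ : ℝ) / ((q₁ : ℝ) * q₂ * r)) *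
        ((Nat.log 2 ⌊2 * N⌋₊ : ℝ) * (2 * N / (z * ((Nat.gcd q₁ q₂ : ℝ) * r)) + 1) * l2Sq N β)
      = |γ q₁| * |γ q₂| * (Nat.log 2 ⌊2 * N⌋₊ : ℝ) * l2Sq N β *
          ((Nat.gcd q₁ q₂ : ℝ) / ((q₁ : ℝ) * q₂ * r) *
            (2 * N / (z * ((Nat.gcd q₁ q₂ : ℝ) * r)) + 1)) := by ring
    _ ≤ (σ 0 q₁ : ℝ) ^ b * (σ 0 q₂ : ℝ) ^ b * (Nat.log 2 ⌊2 * N⌋₊ : ℝ) * l2Sq N β *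
          ((2 * N / (z * R) + Q₀) / ((q₁ : ℝ) * q₂ * r)) := by
        gcongr
    _ = _ := by ring

/-- Piece 3 of `xErr` (`q₀ > Q₀`, the trivial bound for the `X`-term): for `r ≥ R > 0`, `N ≥ 1`,
`|γ₁γ₂|(∑|β|)²/(Lφ(q₀r)) ≤ 3N‖β‖² (τ(q₁)^b/q₁)(τ(q₂)^bτ(q₀)/q₂)(τ(r)/(Rr))`. [folklore] -/
theorem xErr_piece3_le {N R B : ℝ} (hN : 1 ≤ N) (hR : 0 < R) {b : ℕ} (hb : B ≤ b) {γ : ℕ → ℝ}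
    (hγ : ∀ q, |γ q| ≤ (σ 0 q : ℝ) ^ B) (β : ℕ → ℝ) {r q₁ q₂ : ℕ} (hr : 0 < r) (hq₁ : 0 < q₁)
    (hq₂ : 0 < q₂) (hRr : R ≤ r) :
    |γ q₁| * |γ q₂| * (∑ n ∈ dyadic N, |β n|) ^ 2 /
        (((lmod r q₁ q₂ : ℕ) : ℝ) * (Nat.totient (gmod r q₁ q₂) : ℝ)) ≤
      3 * N * l2Sq N β * ((σ 0 q₁ : ℝ) ^ b / q₁) *
        ((σ 0 q₂ : ℝ) ^ b * (σ 0 (Nat.gcd q₁ q₂) : ℝ) / q₂) * ((σ 0 r : ℝ) / (R * r)) := by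
  have hg : 0 < Nat.gcd q₁ q₂ := Nat.gcd_pos_of_pos_left _ hq₁
  have hg0 : (0 : ℝ) < (Nat.gcd q₁ q₂ : ℝ) := by exact_mod_cast hg
  have hr0 : (0 : ℝ) < r := by exact_mod_cast hr
  have hq₁0 : (0 : ℝ) < q₁ := by exact_mod_cast hq₁
  have hq₂0 : (0 : ℝ) < q₂ := by exact_mod_cast hq₂
  have hγ₁ := abs_le_sigma_pow_of_rpow hγ hb hq₁
  have hγ₂ := abs_le_sigma_pow_of_rpow hγ hb hq₂
  have hl := l2Sq_nonneg N β
  have hS := sum_abs_le_sqrt_mul hN β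
  have hS0 : 0 ≤ ∑ n ∈ dyadic N, |β n| := Finset.sum_nonneg fun _ _ => abs_nonneg _
  have hS2 : (∑ n ∈ dyadic N, |β n|) ^ 2 ≤ 3 * N * l2Sq N β := by
    calc (∑ n ∈ dyadic N, |β n|) ^ 2 ≤ (Real.sqrt (3 * N) * Real.sqrt (l2Sq N β)) ^ 2 :=
          pow_le_pow_left₀ hS0 hS 2
      _ = 3 * N * l2Sq N β := by
          rw [mul_pow, Real.sq_sqrt (by linarith), Real.sq_sqrt hl]
  have hφ := inv_totient_mul_le hg hr
  have hφ0 : (0 : ℝ) < (Nat.totient (gmod r q₁ q₂) : ℝ) := by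
    exact_mod_cast Nat.totient_pos.2 (gmod_pos hr hq₁)
  have hGm : gmod r q₁ q₂ = Nat.gcd q₁ q₂ * r := rfl
  rw [hGm] at hφ0 ⊢
  rw [div_eq_mul_inv, mul_inv, inv_lmod_eq hr hq₁ hq₂]
  calc |γ q₁| * |γ q₂| * (∑ n ∈ dyadic N, |β n|) ^ 2 *
        ((Nat.gcd q₁ q₂ : ℝ) / ((q₁ : ℝ) * q₂ * r) * ((Nat.totient (Nat.gcd q₁ q₂ * r) : ℝ))⁻¹)
      ≤ (σ 0 q₁ : ℝ) ^ b * (σ 0 q₂ : ℝ) ^ b * (3 * N * l2Sq N β) *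
          ((Nat.gcd q₁ q₂ : ℝ) / ((q₁ : ℝ) * q₂ * r) *
            ((σ 0 (Nat.gcd q₁ q₂) : ℝ) * (σ 0 r : ℝ) / ((Nat.gcd q₁ q₂ : ℝ) * r))) := by
        gcongr
    _ = 3 * N * l2Sq N β * ((σ 0 q₁ : ℝ) ^ b / q₁) *
          ((σ 0 q₂ : ℝ) ^ b * (σ 0 (Nat.gcd q₁ q₂) : ℝ) / q₂) * ((σ 0 r : ℝ) / ((r : ℝ) * r)) := by
        field_simp
    _ ≤ _ := by gcongr

/-- **The summand `xErr` split into its three averaged pieces** (`q₀ = (q₁,q₂)`, `b ≥ B`,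
`|γ_q| ≤ τ(q)^B`, `r ≥ R > 0`, `N ≥ 1`, `z > 0`):
`xErr ≤ [q₀ ≤ Q₀] τ(q₁)^bτ(q₂)^b (q₀/(q₁q₂)) (2R)⁻¹ (D(q₁/q₀; q₀r) + D(q₂/q₀; q₀r))`
`  + τ(q₁)^bτ(q₂)^b log₂(2N) ‖β‖² (2N/(zR) + Q₀)/(q₁q₂r)`
`  + [q₀ > Q₀] 3N‖β‖² (τ(q₁)^b/q₁)(τ(q₂)^b τ(q₀)/q₂)(τ(r)/(Rr))`.
[cite: BombieriFriedlanderIwaniecActa1986, §7 (7.1)–(7.5) pp. 222–223] -/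
theorem xErr_le_three {N Q₀ z R B : ℝ} (hN : 1 ≤ N) (hQ₀ : 0 ≤ Q₀) (hz : 0 < z) (hR : 0 < R)
    {b : ℕ} (hb : B ≤ b) {γ : ℕ → ℝ} (hγ : ∀ q, |γ q| ≤ (σ 0 q : ℝ) ^ B) (β : ℕ → ℝ)
    {r q₁ q₂ : ℕ} (hr : 0 < r) (hq₁ : 0 < q₁) (hq₂ : 0 < q₂) (hRr : R ≤ r) :
    xErr N Q₀ z β γ r q₁ q₂ ≤
      (if (Nat.gcd q₁ q₂ : ℝ) ≤ Q₀ then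
          (σ 0 q₁ : ℝ) ^ b * (σ 0 q₂ : ℝ) ^ b * ((Nat.gcd q₁ q₂ : ℝ) / ((q₁ : ℝ) * q₂)) *
            (2 * R)⁻¹ *
            (bdhD N β (q₁ / Nat.gcd q₁ q₂) (gmod r q₁ q₂) +
              bdhD N β (q₂ / Nat.gcd q₁ q₂) (gmod r q₁ q₂))
        else 0) +
      (σ 0 q₁ : ℝ) ^ b * (σ 0 q₂ : ℝ) ^ b * ((Nat.log 2 ⌊2 * N⌋₊ : ℝ) * l2Sq N β *
          (2 * N / (z * R) + Q₀)) / ((q₁ : ℝ) * q₂ * r) +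
      (if (Nat.gcd q₁ q₂ : ℝ) ≤ Q₀ then 0 else
          3 * N * l2Sq N β * ((σ 0 q₁ : ℝ) ^ b / q₁) *
            ((σ 0 q₂ : ℝ) ^ b * (σ 0 (Nat.gcd q₁ q₂) : ℝ) / q₂) * ((σ 0 r : ℝ) / (R * r))) := by
  have hr0 : (0 : ℝ) < r := by exact_mod_cast hr
  have hq₁0 : (0 : ℝ) < q₁ := by exact_mod_cast hq₁
  have hq₂0 : (0 : ℝ) < q₂ := by exact_mod_cast hq₂
  have hl := l2Sq_nonneg N β
  have hlog : (0 : ℝ) ≤ (Nat.log 2 ⌊2 * N⌋₊ : ℝ) := Nat.cast_nonneg _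
  have hP2nonneg : 0 ≤ (σ 0 q₁ : ℝ) ^ b * (σ 0 q₂ : ℝ) ^ b * ((Nat.log 2 ⌊2 * N⌋₊ : ℝ) *
      l2Sq N β * (2 * N / (z * R) + Q₀)) / ((q₁ : ℝ) * q₂ * r) := by positivity
  unfold xErr
  split_ifs with hc
  · rw [add_zero]
    have hD := add_nonneg (bdhD_nonneg N β (q₁ / Nat.gcd q₁ q₂) (gmod r q₁ q₂))
      (bdhD_nonneg N β (q₂ / Nat.gcd q₁ q₂) (gmod r q₁ q₂))
    exact add_le_add (xErr_piece1_le hR hb hγ hr hq₁ hq₂ hRr hD)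
      (xErr_piece2_le (by linarith) hz hR hb hγ β hr hq₁ hq₂ hRr hc)
  · rw [zero_add]
    have h3 := xErr_piece3_le hN hR hb hγ β hr hq₁ hq₂ hRr
    linarith

/-! ### Summing the three pieces -/

/-- `∑_{r} c g(r) S = c (∑_r g(r)) S`. [folklore] -/
theorem sum_const_mul_mul_const {ι : Type*} (s : Finset ι) (c S : ℝ) (g : ι → ℝ) :
    ∑ r ∈ s, c * g r * S = c * (∑ r ∈ s, g r) * S := by
  rw [Finset.mul_sum, Finset.sum_mul]


/-- `∑_{q∼Q} τ(q)^k/q ≤ S` from the hypothesis on `∑_{m ≤ 2Q} τ(m)^k/m`. [folklore] -/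
theorem sum_dyadic_sigma_pow_div_le_of {Q S : ℝ} (hQ : 0 ≤ Q) {k : ℕ}
    (hS : ∑ m ∈ Icc 1 ⌊2 * Q⌋₊, (σ 0 m : ℝ) ^ k / m ≤ S) :
    ∑ q ∈ dyadic Q, (σ 0 q : ℝ) ^ k / q ≤ S :=
  (sum_dyadic_sigma_pow_div_le_Icc hQ k).trans hS

/-- **Piece 2 summed**: `∑_{r,q₁,q₂} τ₁^bτ₂^b C/(q₁q₂r) ≤ 4 C S_b²` (`C ≥ 0`). [folklore] -/
theorem sum_piece2_le {Q R C Sb : ℝ} (hQ : 1 / 2 ≤ Q) (hR : 1 / 2 ≤ R) (hC : 0 ≤ C) {b : ℕ}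
    (hSb : ∑ m ∈ Icc 1 ⌊2 * Q⌋₊, (σ 0 m : ℝ) ^ b / m ≤ Sb) :
    ∑ r ∈ dyadic R, ∑ q₁ ∈ dyadic Q, ∑ q₂ ∈ dyadic Q,
        (σ 0 q₁ : ℝ) ^ b * (σ 0 q₂ : ℝ) ^ b * C / ((q₁ : ℝ) * q₂ * r) ≤ 4 * C * Sb ^ 2 := by
  have hQ0 : 0 ≤ Q := by linarith
  have hSQ := sum_dyadic_sigma_pow_div_le_of hQ0 hSb
  have hSQ0 : 0 ≤ ∑ q ∈ dyadic Q, (σ 0 q : ℝ) ^ b / q :=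
    Finset.sum_nonneg fun q _ => by positivity
  have hSb0 : 0 ≤ Sb := hSQ0.trans hSQ
  have hSR := sum_dyadic_inv_le hR
  calc ∑ r ∈ dyadic R, ∑ q₁ ∈ dyadic Q, ∑ q₂ ∈ dyadic Q,
        (σ 0 q₁ : ℝ) ^ b * (σ 0 q₂ : ℝ) ^ b * C / ((q₁ : ℝ) * q₂ * r)
      = ∑ r ∈ dyadic R, ∑ q₁ ∈ dyadic Q, ∑ q₂ ∈ dyadic Q,
          C * ((σ 0 q₁ : ℝ) ^ b / q₁) * ((σ 0 q₂ : ℝ) ^ b / q₂) * (1 / (r : ℝ)) := by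
        refine Finset.sum_congr rfl fun r hr => Finset.sum_congr rfl fun q₁ hq₁ =>
          Finset.sum_congr rfl fun q₂ hq₂ => ?_
        have hr0 : (0 : ℝ) < r := by exact_mod_cast pos_of_mem_dyadic (by linarith) hr
        have hq₁0 : (0 : ℝ) < q₁ := by exact_mod_cast pos_of_mem_dyadic hQ0 hq₁
        have hq₂0 : (0 : ℝ) < q₂ := by exact_mod_cast pos_of_mem_dyadic hQ0 hq₂
        field_simp
    _ = C * ((∑ q ∈ dyadic Q, (σ 0 q : ℝ) ^ b / q) * (∑ q ∈ dyadic Q, (σ 0 q : ℝ) ^ b / q) *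
          ∑ r ∈ dyadic R, (1 / (r : ℝ))) := by
        simp only [← Finset.sum_mul, ← Finset.mul_sum]
        ring
    _ ≤ C * (Sb * Sb * 4) := by
        refine mul_le_mul_of_nonneg_left ?_ hC
        exact mul_le_mul (mul_le_mul hSQ hSQ hSQ0 hSb0) hSR
          (Finset.sum_nonneg fun r _ => by positivity) (by positivity)
    _ = 4 * C * Sb ^ 2 := by ring

/-- **The double sum of piece 3** (`q₀ > Q₀`): for `Q₀ > 0`,
`∑_{q₁,q₂∼Q, q₀>Q₀} (τ₁^b/q₁)(τ₂^bτ(q₀)/q₂) ≤ S_b S_{2b+2}/Q₀`. [folklore] -/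
theorem sum_piece3_qq_le {Q Q₀ Sb S2 : ℝ} (hQ : 0 ≤ Q) (hQ₀ : 0 < Q₀) {b : ℕ}
    (hSb : ∑ m ∈ Icc 1 ⌊2 * Q⌋₊, (σ 0 m : ℝ) ^ b / m ≤ Sb)
    (hS2 : ∑ m ∈ Icc 1 ⌊2 * Q⌋₊, (σ 0 m : ℝ) ^ (2 * b + 2) / m ≤ S2) :
    ∑ q₁ ∈ dyadic Q, ∑ q₂ ∈ dyadic Q,
        (if (Nat.gcd q₁ q₂ : ℝ) ≤ Q₀ then 0 else
          ((σ 0 q₁ : ℝ) ^ b / q₁) * ((σ 0 q₂ : ℝ) ^ b * (σ 0 (Nat.gcd q₁ q₂) : ℝ) / q₂)) ≤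
      Sb * S2 / Q₀ := by
  have hSb0 : 0 ≤ Sb := le_trans (Finset.sum_nonneg fun m _ => by positivity) hSb
  -- inner bound for fixed `q₁`
  have hinner : ∀ q₁ ∈ dyadic Q, ∑ q₂ ∈ dyadic Q,
      (if (Nat.gcd q₁ q₂ : ℝ) ≤ Q₀ then 0 else
        ((σ 0 q₁ : ℝ) ^ b / q₁) * ((σ 0 q₂ : ℝ) ^ b * (σ 0 (Nat.gcd q₁ q₂) : ℝ) / q₂)) ≤
      ((σ 0 q₁ : ℝ) ^ b / q₁) * ((σ 0 q₁ : ℝ) ^ (b + 2) * (Sb / Q₀)) := by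
    intro q₁ hq₁
    have hq₁0 := pos_of_mem_dyadic hQ hq₁
    have hq₁0' : (0 : ℝ) < q₁ := by exact_mod_cast hq₁0
    -- rewrite the indicator with `¬` and pull the factor of `q₁`
    have e : ∀ q₂ : ℕ, (if (Nat.gcd q₁ q₂ : ℝ) ≤ Q₀ then 0 else
        ((σ 0 q₁ : ℝ) ^ b / q₁) * ((σ 0 q₂ : ℝ) ^ b * (σ 0 (Nat.gcd q₁ q₂) : ℝ) / q₂)) =
        ((σ 0 q₁ : ℝ) ^ b / q₁) * (if ¬ ((Nat.gcd q₁ q₂ : ℝ) ≤ Q₀) then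
          (σ 0 q₂ : ℝ) ^ b * (σ 0 (Nat.gcd q₁ q₂) : ℝ) / q₂ else 0) := by
      intro q₂; split_ifs <;> simp
    simp only [e, ← Finset.mul_sum]
    refine mul_le_mul_of_nonneg_left ?_ (by positivity)
    refine (sum_gcd_le_sum_divisors hq₁0 Q (fun g : ℕ => ¬ ((g : ℝ) ≤ Q₀))
      (F := fun g q₂ => (σ 0 q₂ : ℝ) ^ b * (σ 0 g : ℝ) / q₂) (fun g q₂ => by positivity)).trans ?_
    -- each `g`: `∑_{g ∣ q₂} τ₂^b τ(g)/q₂ ≤ τ(g)^{b+1}/g · Sb ≤ τ(g)^{b+1} Sb / Q₀`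
    have hg_le : ∀ g ∈ q₁.divisors.filter (fun g : ℕ => ¬ ((g : ℝ) ≤ Q₀)),
        ∑ q₂ ∈ (dyadic Q).filter (fun q₂ => g ∣ q₂), (σ 0 q₂ : ℝ) ^ b * (σ 0 g : ℝ) / q₂ ≤
          (σ 0 g : ℝ) ^ (b + 1) * (Sb / Q₀) := by
      intro g hg
      rw [Finset.mem_filter, Nat.mem_divisors] at hg
      have hg0 : 0 < g := Nat.pos_of_dvd_of_pos hg.1.1 hq₁0
      have hg0' : (0 : ℝ) < g := by exact_mod_cast hg0
      have hgQ : Q₀ < (g : ℝ) := lt_of_not_ge hg.2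
      have e2 : ∀ q₂ : ℕ, (σ 0 q₂ : ℝ) ^ b * (σ 0 g : ℝ) / q₂ = (σ 0 g : ℝ) * ((σ 0 q₂ : ℝ) ^ b / q₂) := by
        intro q₂; ring
      simp only [e2, ← Finset.mul_sum]
      have h1 := sum_dyadic_filter_dvd_le hg0 hQ b
      calc (σ 0 g : ℝ) * ∑ q₂ ∈ (dyadic Q).filter (fun q₂ => g ∣ q₂), (σ 0 q₂ : ℝ) ^ b / q₂
          ≤ (σ 0 g : ℝ) * ((σ 0 g : ℝ) ^ b / g * Sb) := by
            refine mul_le_mul_of_nonneg_left (h1.trans ?_) (by positivity)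
            exact mul_le_mul_of_nonneg_left hSb (by positivity)
        _ = (σ 0 g : ℝ) ^ (b + 1) * (Sb / g) := by rw [pow_succ]; field_simp
        _ ≤ (σ 0 g : ℝ) ^ (b + 1) * (Sb / Q₀) := by
            refine mul_le_mul_of_nonneg_left ?_ (by positivity)
            exact div_le_div_of_nonneg_left hSb0 hQ₀ hgQ.le
    calc ∑ g ∈ q₁.divisors.filter (fun g : ℕ => ¬ ((g : ℝ) ≤ Q₀)),
          ∑ q₂ ∈ (dyadic Q).filter (fun q₂ => g ∣ q₂), (σ 0 q₂ : ℝ) ^ b * (σ 0 g : ℝ) / q₂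
        ≤ ∑ g ∈ q₁.divisors.filter (fun g : ℕ => ¬ ((g : ℝ) ≤ Q₀)), (σ 0 g : ℝ) ^ (b + 1) * (Sb / Q₀) :=
          Finset.sum_le_sum hg_le
      _ = (∑ g ∈ q₁.divisors.filter (fun g : ℕ => ¬ ((g : ℝ) ≤ Q₀)), (σ 0 g : ℝ) ^ (b + 1)) *
            (Sb / Q₀) := by rw [Finset.sum_mul]
      _ ≤ (σ 0 q₁ : ℝ) ^ (b + 2) * (Sb / Q₀) :=
          mul_le_mul_of_nonneg_right (sum_divisors_filter_sigma_pow_le hq₁0 _ (b + 1))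
            (by positivity)
  calc ∑ q₁ ∈ dyadic Q, ∑ q₂ ∈ dyadic Q,
        (if (Nat.gcd q₁ q₂ : ℝ) ≤ Q₀ then 0 else
          ((σ 0 q₁ : ℝ) ^ b / q₁) * ((σ 0 q₂ : ℝ) ^ b * (σ 0 (Nat.gcd q₁ q₂) : ℝ) / q₂))
      ≤ ∑ q₁ ∈ dyadic Q, ((σ 0 q₁ : ℝ) ^ b / q₁) * ((σ 0 q₁ : ℝ) ^ (b + 2) * (Sb / Q₀)) :=
        Finset.sum_le_sum hinner
    _ = (∑ q₁ ∈ dyadic Q, (σ 0 q₁ : ℝ) ^ (2 * b + 2) / q₁) * (Sb / Q₀) := by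
        rw [Finset.sum_mul]
        refine Finset.sum_congr rfl fun q₁ _ => ?_
        rw [show 2 * b + 2 = b + (b + 2) by ring, pow_add]
        ring
    _ ≤ S2 * (Sb / Q₀) :=
        mul_le_mul_of_nonneg_right (sum_dyadic_sigma_pow_div_le_of hQ hS2) (by positivity)
    _ = Sb * S2 / Q₀ := by ring

/-- **Piece 3 summed**: `∑_{r,q₁,q₂: q₀>Q₀} 3N‖β‖²(τ₁^b/q₁)(τ₂^bτ(q₀)/q₂)(τ(r)/(Rr)) ≤ 3N‖β‖² S₁S_bS_{2b+2}/(RQ₀)`.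
[folklore] -/
theorem sum_piece3_le {N Q R Q₀ Sb S2 S1 : ℝ} (hN : 0 ≤ N) (hQ : 0 ≤ Q) (hR : 0 < R)
    (hQ₀ : 0 < Q₀) (β : ℕ → ℝ) {b : ℕ}
    (hSb : ∑ m ∈ Icc 1 ⌊2 * Q⌋₊, (σ 0 m : ℝ) ^ b / m ≤ Sb)
    (hS2 : ∑ m ∈ Icc 1 ⌊2 * Q⌋₊, (σ 0 m : ℝ) ^ (2 * b + 2) / m ≤ S2)
    (hS1 : ∑ m ∈ Icc 1 ⌊2 * R⌋₊, (σ 0 m : ℝ) / m ≤ S1) :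
    ∑ r ∈ dyadic R, ∑ q₁ ∈ dyadic Q, ∑ q₂ ∈ dyadic Q,
        (if (Nat.gcd q₁ q₂ : ℝ) ≤ Q₀ then 0 else
          3 * N * l2Sq N β * ((σ 0 q₁ : ℝ) ^ b / q₁) *
            ((σ 0 q₂ : ℝ) ^ b * (σ 0 (Nat.gcd q₁ q₂) : ℝ) / q₂) * ((σ 0 r : ℝ) / (R * r))) ≤
      3 * N * l2Sq N β * S1 * Sb * S2 / (R * Q₀) := by
  have hl := l2Sq_nonneg N β
  have hSb0 : 0 ≤ Sb := le_trans (Finset.sum_nonneg fun m _ => by positivity) hSb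
  -- factor the `r`-dependence
  have e : ∀ r q₁ q₂ : ℕ, (if (Nat.gcd q₁ q₂ : ℝ) ≤ Q₀ then 0 else
      3 * N * l2Sq N β * ((σ 0 q₁ : ℝ) ^ b / q₁) *
        ((σ 0 q₂ : ℝ) ^ b * (σ 0 (Nat.gcd q₁ q₂) : ℝ) / q₂) * ((σ 0 r : ℝ) / (R * r))) =
      (3 * N * l2Sq N β * ((σ 0 r : ℝ) / (R * r))) *
        (if (Nat.gcd q₁ q₂ : ℝ) ≤ Q₀ then 0 else
          ((σ 0 q₁ : ℝ) ^ b / q₁) * ((σ 0 q₂ : ℝ) ^ b * (σ 0 (Nat.gcd q₁ q₂) : ℝ) / q₂)) := by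
    intro r q₁ q₂; split_ifs <;> ring
  simp only [e, ← Finset.mul_sum]
  have hqq := sum_piece3_qq_le hQ hQ₀ hSb hS2
  have hqq0 : 0 ≤ ∑ q₁ ∈ dyadic Q, ∑ q₂ ∈ dyadic Q,
      (if (Nat.gcd q₁ q₂ : ℝ) ≤ Q₀ then 0 else
        ((σ 0 q₁ : ℝ) ^ b / q₁) * ((σ 0 q₂ : ℝ) ^ b * (σ 0 (Nat.gcd q₁ q₂) : ℝ) / q₂)) :=
    Finset.sum_nonneg fun q₁ _ => Finset.sum_nonneg fun q₂ _ => by split_ifs <;> positivity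
  -- the `r`-sum
  have hSR : ∑ r ∈ dyadic R, (σ 0 r : ℝ) / (R * r) ≤ S1 / R := by
    have h1 : ∑ r ∈ dyadic R, (σ 0 r : ℝ) ^ 1 / r ≤ S1 := by
      refine sum_dyadic_sigma_pow_div_le_of hR.le ?_
      simpa only [pow_one] using hS1
    simp only [pow_one] at h1
    have e2 : ∀ r : ℕ, (σ 0 r : ℝ) / (R * r) = R⁻¹ * ((σ 0 r : ℝ) / r) := by
      intro r; rw [mul_comm R, ← div_div, div_eq_mul_inv _ R, mul_comm]
    simp only [e2, ← Finset.mul_sum]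
    rw [div_eq_mul_inv S1 R, mul_comm S1]
    exact mul_le_mul_of_nonneg_left h1 (by positivity)
  calc ∑ r ∈ dyadic R, 3 * N * l2Sq N β * ((σ 0 r : ℝ) / (R * r)) *
        ∑ q₁ ∈ dyadic Q, ∑ q₂ ∈ dyadic Q,
          (if (Nat.gcd q₁ q₂ : ℝ) ≤ Q₀ then 0 else
            ((σ 0 q₁ : ℝ) ^ b / q₁) * ((σ 0 q₂ : ℝ) ^ b * (σ 0 (Nat.gcd q₁ q₂) : ℝ) / q₂))
      = 3 * N * l2Sq N β * (∑ r ∈ dyadic R, (σ 0 r : ℝ) / (R * r)) *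
          ∑ q₁ ∈ dyadic Q, ∑ q₂ ∈ dyadic Q,
            (if (Nat.gcd q₁ q₂ : ℝ) ≤ Q₀ then 0 else
              ((σ 0 q₁ : ℝ) ^ b / q₁) * ((σ 0 q₂ : ℝ) ^ b * (σ 0 (Nat.gcd q₁ q₂) : ℝ) / q₂)) :=
        sum_const_mul_mul_const _ _ _ _
    _ ≤ 3 * N * l2Sq N β * (S1 / R) * (Sb * S2 / Q₀) := by
        have hS10 : 0 ≤ S1 / R := by
          have h0 : 0 ≤ ∑ r ∈ dyadic R, (σ 0 r : ℝ) / (R * r) :=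
            Finset.sum_nonneg fun r _ => by positivity
          exact h0.trans hSR
        refine mul_le_mul ?_ hqq hqq0 (by positivity)
        exact mul_le_mul_of_nonneg_left hSR (by positivity)
    _ = _ := by field_simp

/-- **The weight sum behind the Barban–Davenport–Halberstam piece**:
`∑_{q₁,q₂∼Q, q₀ ≤ Q₀} τ₁^{b+c} τ₂^b q₀/(q₁q₂) ≤ S_b S_{2b+c+1}` (the condition `q₀ ≤ Q₀` is only
used to have a definite statement; `c = b` is the case needed). [folklore] -/
theorem bdh_weight_sum_le {Q Q₀ Sb S3 : ℝ} (hQ : 0 ≤ Q) {b c : ℕ}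
    (hSb : ∑ m ∈ Icc 1 ⌊2 * Q⌋₊, (σ 0 m : ℝ) ^ b / m ≤ Sb)
    (hS3 : ∑ m ∈ Icc 1 ⌊2 * Q⌋₊, (σ 0 m : ℝ) ^ (2 * b + c + 1) / m ≤ S3) :
    ∑ q₁ ∈ dyadic Q, ∑ q₂ ∈ dyadic Q,
        (if (Nat.gcd q₁ q₂ : ℝ) ≤ Q₀ then
          (σ 0 q₁ : ℝ) ^ (b + c) * (σ 0 q₂ : ℝ) ^ b * ((Nat.gcd q₁ q₂ : ℝ) / ((q₁ : ℝ) * q₂))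
        else 0) ≤ Sb * S3 := by
  have hSb0 : 0 ≤ Sb := le_trans (Finset.sum_nonneg fun m _ => by positivity) hSb
  have hinner : ∀ q₁ ∈ dyadic Q, ∑ q₂ ∈ dyadic Q,
      (if (Nat.gcd q₁ q₂ : ℝ) ≤ Q₀ then
        (σ 0 q₁ : ℝ) ^ (b + c) * (σ 0 q₂ : ℝ) ^ b * ((Nat.gcd q₁ q₂ : ℝ) / ((q₁ : ℝ) * q₂))
        else 0) ≤ ((σ 0 q₁ : ℝ) ^ (b + c) / q₁) * ((σ 0 q₁ : ℝ) ^ (b + 1) * Sb) := by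
    intro q₁ hq₁
    have hq₁0 := pos_of_mem_dyadic hQ hq₁
    have hq₁0' : (0 : ℝ) < q₁ := by exact_mod_cast hq₁0
    have e : ∀ q₂ : ℕ, (if (Nat.gcd q₁ q₂ : ℝ) ≤ Q₀ then
        (σ 0 q₁ : ℝ) ^ (b + c) * (σ 0 q₂ : ℝ) ^ b * ((Nat.gcd q₁ q₂ : ℝ) / ((q₁ : ℝ) * q₂))
        else 0) = ((σ 0 q₁ : ℝ) ^ (b + c) / q₁) * (if (Nat.gcd q₁ q₂ : ℝ) ≤ Q₀ then
          (Nat.gcd q₁ q₂ : ℝ) * ((σ 0 q₂ : ℝ) ^ b / q₂) else 0) := by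
      intro q₂
      split_ifs
      · field_simp
      · simp
    simp only [e, ← Finset.mul_sum]
    refine mul_le_mul_of_nonneg_left ?_ (by positivity)
    refine (sum_gcd_le_sum_divisors hq₁0 Q (fun g : ℕ => (g : ℝ) ≤ Q₀)
      (F := fun g q₂ => (g : ℝ) * ((σ 0 q₂ : ℝ) ^ b / q₂)) (fun g q₂ => by positivity)).trans ?_
    have hg_le : ∀ g ∈ q₁.divisors.filter (fun g : ℕ => (g : ℝ) ≤ Q₀),
        ∑ q₂ ∈ (dyadic Q).filter (fun q₂ => g ∣ q₂), (g : ℝ) * ((σ 0 q₂ : ℝ) ^ b / q₂) ≤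
          (σ 0 g : ℝ) ^ b * Sb := by
      intro g hg
      rw [Finset.mem_filter, Nat.mem_divisors] at hg
      have hg0 : 0 < g := Nat.pos_of_dvd_of_pos hg.1.1 hq₁0
      have hg0' : (0 : ℝ) < g := by exact_mod_cast hg0
      rw [← Finset.mul_sum]
      have h1 := sum_dyadic_filter_dvd_le hg0 hQ b
      calc (g : ℝ) * ∑ q₂ ∈ (dyadic Q).filter (fun q₂ => g ∣ q₂), (σ 0 q₂ : ℝ) ^ b / q₂
          ≤ (g : ℝ) * ((σ 0 g : ℝ) ^ b / g * Sb) := by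
            refine mul_le_mul_of_nonneg_left (h1.trans ?_) (by positivity)
            exact mul_le_mul_of_nonneg_left hSb (by positivity)
        _ = (σ 0 g : ℝ) ^ b * Sb := by field_simp
    calc ∑ g ∈ q₁.divisors.filter (fun g : ℕ => (g : ℝ) ≤ Q₀),
          ∑ q₂ ∈ (dyadic Q).filter (fun q₂ => g ∣ q₂), (g : ℝ) * ((σ 0 q₂ : ℝ) ^ b / q₂)
        ≤ ∑ g ∈ q₁.divisors.filter (fun g : ℕ => (g : ℝ) ≤ Q₀), (σ 0 g : ℝ) ^ b * Sb :=
          Finset.sum_le_sum hg_le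
      _ = (∑ g ∈ q₁.divisors.filter (fun g : ℕ => (g : ℝ) ≤ Q₀), (σ 0 g : ℝ) ^ b) * Sb := by
          rw [Finset.sum_mul]
      _ ≤ (σ 0 q₁ : ℝ) ^ (b + 1) * Sb :=
          mul_le_mul_of_nonneg_right (sum_divisors_filter_sigma_pow_le hq₁0 _ b) hSb0
  calc ∑ q₁ ∈ dyadic Q, ∑ q₂ ∈ dyadic Q,
        (if (Nat.gcd q₁ q₂ : ℝ) ≤ Q₀ then
          (σ 0 q₁ : ℝ) ^ (b + c) * (σ 0 q₂ : ℝ) ^ b * ((Nat.gcd q₁ q₂ : ℝ) / ((q₁ : ℝ) * q₂))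
        else 0)
      ≤ ∑ q₁ ∈ dyadic Q, ((σ 0 q₁ : ℝ) ^ (b + c) / q₁) * ((σ 0 q₁ : ℝ) ^ (b + 1) * Sb) :=
        Finset.sum_le_sum hinner
    _ = (∑ q₁ ∈ dyadic Q, (σ 0 q₁ : ℝ) ^ (2 * b + c + 1) / q₁) * Sb := by
        rw [Finset.sum_mul]
        refine Finset.sum_congr rfl fun q₁ _ => ?_
        rw [show 2 * b + c + 1 = (b + c) + (b + 1) by ring, pow_add]
        ring
    _ ≤ S3 * Sb := mul_le_mul_of_nonneg_right (sum_dyadic_sigma_pow_div_le_of hQ hS3) hSb0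
    _ = Sb * S3 := by ring


/-- **Piece 1 summed over `r` for fixed `q₁, q₂`** (Theorem 0 (a) enters here, as the hypothesis
`h0a` on `∑_{q ≤ 2Q₀R} D(d; q)`): for `q₀ ≤ Q₀`,
`∑_{r∼R} (D(q₁/q₀; q₀r) + D(q₂/q₀; q₀r)) ≤ W₀ (τ(q₁)^b + τ(q₂)^b)`. [folklore] -/
theorem sum_r_bdh_le {N Q₀ R B W0 : ℝ} (hR : 0 ≤ R) {b : ℕ} (hb : B ≤ b) (β : ℕ → ℝ)
    (hW0 : 0 ≤ W0)
    (h0a : ∀ d : ℕ, 1 ≤ d → ∑ q ∈ Icc 1 ⌊2 * Q₀ * R⌋₊, bdhD N β d q ≤ W0 * (σ 0 d : ℝ) ^ B)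
    {q₁ q₂ : ℕ} (hq₁ : 0 < q₁) (hq₂ : 0 < q₂) (hgQ : (Nat.gcd q₁ q₂ : ℝ) ≤ Q₀) :
    ∑ r ∈ dyadic R, (bdhD N β (q₁ / Nat.gcd q₁ q₂) (gmod r q₁ q₂) +
        bdhD N β (q₂ / Nat.gcd q₁ q₂) (gmod r q₁ q₂)) ≤
      W0 * ((σ 0 q₁ : ℝ) ^ b + (σ 0 q₂ : ℝ) ^ b) := by
  set g := Nat.gcd q₁ q₂ with hgdef
  have hg : 0 < g := Nat.gcd_pos_of_pos_left _ hq₁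
  -- `d = qᵢ/g ≥ 1`, `d ∣ qᵢ`
  have hd : ∀ {q : ℕ}, 0 < q → g ∣ q → 1 ≤ q / g ∧ q / g ∣ q := fun hq hgq =>
    ⟨Nat.div_pos (Nat.le_of_dvd hq hgq) hg, Nat.div_dvd_of_dvd hgq⟩
  have hone : ∀ {q : ℕ}, 0 < q → g ∣ q →
      ∑ r ∈ dyadic R, bdhD N β (q / g) (gmod r q₁ q₂) ≤ W0 * (σ 0 q : ℝ) ^ b := by
    intro q hq hgq
    obtain ⟨hd1, hdd⟩ := hd hq hgq
    have h1 : ∑ r ∈ dyadic R, bdhD N β (q / g) (gmod r q₁ q₂) ≤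
        ∑ q' ∈ Icc 1 ⌊2 * Q₀ * R⌋₊, bdhD N β (q / g) q' :=
      sum_dyadic_comp_mul_le (f := fun q' => bdhD N β (q / g) q') (fun q' => bdhD_nonneg N β _ q')
        hg hgQ hR
    refine h1.trans ((h0a (q / g) hd1).trans (mul_le_mul_of_nonneg_left ?_ hW0))
    have hdpos : 0 < q / g := hd1
    calc (σ 0 (q / g) : ℝ) ^ B ≤ (σ 0 (q / g) : ℝ) ^ b := sigma_rpow_le_pow hb hdpos
      _ ≤ (σ 0 q : ℝ) ^ b := pow_le_pow_left₀ (by positivity)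
          (by exact_mod_cast sigma_zero_le_of_dvd hq.ne' hdd) b
  rw [Finset.sum_add_distrib, mul_add]
  exact add_le_add (hone hq₁ (Nat.gcd_dvd_left q₁ q₂)) (hone hq₂ (Nat.gcd_dvd_right q₁ q₂))

/-- **Piece 1 summed**: `∑_{r,q₁,q₂} P₁ ≤ W₀ S_b S_{3b+1} / R`. [folklore] -/
theorem sum_piece1_le {N Q R Q₀ B W0 Sb S3 : ℝ} (hQ : 0 ≤ Q) (hR : 0 < R) {b : ℕ} (hb : B ≤ b)
    (β : ℕ → ℝ) (hW0 : 0 ≤ W0)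
    (h0a : ∀ d : ℕ, 1 ≤ d → ∑ q ∈ Icc 1 ⌊2 * Q₀ * R⌋₊, bdhD N β d q ≤ W0 * (σ 0 d : ℝ) ^ B)
    (hSb : ∑ m ∈ Icc 1 ⌊2 * Q⌋₊, (σ 0 m : ℝ) ^ b / m ≤ Sb)
    (hS3 : ∑ m ∈ Icc 1 ⌊2 * Q⌋₊, (σ 0 m : ℝ) ^ (3 * b + 1) / m ≤ S3) :
    ∑ r ∈ dyadic R, ∑ q₁ ∈ dyadic Q, ∑ q₂ ∈ dyadic Q,
        (if (Nat.gcd q₁ q₂ : ℝ) ≤ Q₀ then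
            (σ 0 q₁ : ℝ) ^ b * (σ 0 q₂ : ℝ) ^ b * ((Nat.gcd q₁ q₂ : ℝ) / ((q₁ : ℝ) * q₂)) *
              (2 * R)⁻¹ *
              (bdhD N β (q₁ / Nat.gcd q₁ q₂) (gmod r q₁ q₂) +
                bdhD N β (q₂ / Nat.gcd q₁ q₂) (gmod r q₁ q₂))
          else 0) ≤ W0 * Sb * S3 / R := by
  have hSb0 : 0 ≤ Sb := le_trans (Finset.sum_nonneg fun m _ => by positivity) hSb
  have hS3' : ∑ m ∈ Icc 1 ⌊2 * Q⌋₊, (σ 0 m : ℝ) ^ (2 * b + b + 1) / m ≤ S3 := by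
    rwa [show 2 * b + b + 1 = 3 * b + 1 by ring]
  -- the two weight sums
  have hA := bdh_weight_sum_le (Q₀ := Q₀) hQ hSb hS3'
  have hA' : ∑ q₁ ∈ dyadic Q, ∑ q₂ ∈ dyadic Q,
      (if (Nat.gcd q₁ q₂ : ℝ) ≤ Q₀ then
        (σ 0 q₁ : ℝ) ^ b * (σ 0 q₂ : ℝ) ^ (b + b) * ((Nat.gcd q₁ q₂ : ℝ) / ((q₁ : ℝ) * q₂))
        else 0) ≤ Sb * S3 := by
    refine le_of_eq_of_le ?_ hA
    refine Finset.sum_comm.trans (Finset.sum_congr rfl fun q₁ _ => Finset.sum_congr rfl fun q₂ _ => ?_)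
    rw [Nat.gcd_comm]
    split_ifs <;> ring
  -- `r` innermost
  rw [Finset.sum_comm]
  simp_rw [Finset.sum_comm (s := dyadic R) (t := dyadic Q)]
  -- bound the `r`-sums
  have hstep : ∀ q₁ ∈ dyadic Q, ∀ q₂ ∈ dyadic Q,
      ∑ r ∈ dyadic R, (if (Nat.gcd q₁ q₂ : ℝ) ≤ Q₀ then
          (σ 0 q₁ : ℝ) ^ b * (σ 0 q₂ : ℝ) ^ b * ((Nat.gcd q₁ q₂ : ℝ) / ((q₁ : ℝ) * q₂)) *
            (2 * R)⁻¹ *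
            (bdhD N β (q₁ / Nat.gcd q₁ q₂) (gmod r q₁ q₂) +
              bdhD N β (q₂ / Nat.gcd q₁ q₂) (gmod r q₁ q₂))
          else 0) ≤
        (2 * R)⁻¹ * W0 *
          ((if (Nat.gcd q₁ q₂ : ℝ) ≤ Q₀ then
              (σ 0 q₁ : ℝ) ^ (b + b) * (σ 0 q₂ : ℝ) ^ b * ((Nat.gcd q₁ q₂ : ℝ) / ((q₁ : ℝ) * q₂))
            else 0) +
           (if (Nat.gcd q₁ q₂ : ℝ) ≤ Q₀ then
              (σ 0 q₁ : ℝ) ^ b * (σ 0 q₂ : ℝ) ^ (b + b) * ((Nat.gcd q₁ q₂ : ℝ) / ((q₁ : ℝ) * q₂))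
            else 0)) := by
    intro q₁ hq₁ q₂ hq₂
    have hq₁0 := pos_of_mem_dyadic hQ hq₁
    have hq₂0 := pos_of_mem_dyadic hQ hq₂
    split_ifs with hc
    · rw [← Finset.mul_sum]
      have h := sum_r_bdh_le hR.le hb β hW0 h0a hq₁0 hq₂0 hc
      calc (σ 0 q₁ : ℝ) ^ b * (σ 0 q₂ : ℝ) ^ b * ((Nat.gcd q₁ q₂ : ℝ) / ((q₁ : ℝ) * q₂)) *
            (2 * R)⁻¹ * ∑ r ∈ dyadic R, (bdhD N β (q₁ / Nat.gcd q₁ q₂) (gmod r q₁ q₂) +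
              bdhD N β (q₂ / Nat.gcd q₁ q₂) (gmod r q₁ q₂))
          ≤ (σ 0 q₁ : ℝ) ^ b * (σ 0 q₂ : ℝ) ^ b * ((Nat.gcd q₁ q₂ : ℝ) / ((q₁ : ℝ) * q₂)) *
            (2 * R)⁻¹ * (W0 * ((σ 0 q₁ : ℝ) ^ b + (σ 0 q₂ : ℝ) ^ b)) :=
            mul_le_mul_of_nonneg_left h (by positivity)
        _ = _ := by ring
    · simp
  calc ∑ q₁ ∈ dyadic Q, ∑ q₂ ∈ dyadic Q, ∑ r ∈ dyadic R,
        (if (Nat.gcd q₁ q₂ : ℝ) ≤ Q₀ then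
          (σ 0 q₁ : ℝ) ^ b * (σ 0 q₂ : ℝ) ^ b * ((Nat.gcd q₁ q₂ : ℝ) / ((q₁ : ℝ) * q₂)) *
            (2 * R)⁻¹ *
            (bdhD N β (q₁ / Nat.gcd q₁ q₂) (gmod r q₁ q₂) +
              bdhD N β (q₂ / Nat.gcd q₁ q₂) (gmod r q₁ q₂))
          else 0)
      ≤ ∑ q₁ ∈ dyadic Q, ∑ q₂ ∈ dyadic Q, (2 * R)⁻¹ * W0 *
          ((if (Nat.gcd q₁ q₂ : ℝ) ≤ Q₀ then
              (σ 0 q₁ : ℝ) ^ (b + b) * (σ 0 q₂ : ℝ) ^ b * ((Nat.gcd q₁ q₂ : ℝ) / ((q₁ : ℝ) * q₂))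
            else 0) +
           (if (Nat.gcd q₁ q₂ : ℝ) ≤ Q₀ then
              (σ 0 q₁ : ℝ) ^ b * (σ 0 q₂ : ℝ) ^ (b + b) * ((Nat.gcd q₁ q₂ : ℝ) / ((q₁ : ℝ) * q₂))
            else 0)) :=
        Finset.sum_le_sum fun q₁ hq₁ => Finset.sum_le_sum fun q₂ hq₂ => hstep q₁ hq₁ q₂ hq₂
    _ = (2 * R)⁻¹ * W0 *
          ((∑ q₁ ∈ dyadic Q, ∑ q₂ ∈ dyadic Q, (if (Nat.gcd q₁ q₂ : ℝ) ≤ Q₀ then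
              (σ 0 q₁ : ℝ) ^ (b + b) * (σ 0 q₂ : ℝ) ^ b * ((Nat.gcd q₁ q₂ : ℝ) / ((q₁ : ℝ) * q₂))
            else 0)) +
           ∑ q₁ ∈ dyadic Q, ∑ q₂ ∈ dyadic Q, (if (Nat.gcd q₁ q₂ : ℝ) ≤ Q₀ then
              (σ 0 q₁ : ℝ) ^ b * (σ 0 q₂ : ℝ) ^ (b + b) * ((Nat.gcd q₁ q₂ : ℝ) / ((q₁ : ℝ) * q₂))
            else 0)) := by
        simp only [← Finset.mul_sum, Finset.sum_add_distrib]
    _ ≤ (2 * R)⁻¹ * W0 * (Sb * S3 + Sb * S3) := by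
        gcongr
    _ = W0 * Sb * S3 / R := by field_simp; ring

/-! ### The averaged bound for `𝒳 − X` -/

/-- **`𝒳 = X + O(…)`, averaged** (BFI §7, (7.1) p. 222: "`𝒳` is asymptotically equal to `X`, apart
from the admissible error term `O(‖β‖²NR⁻¹ℒ^{−A})` (7.1).  This result is essentially of the type of
the Barban–Davenport–Halberstam theorem and rests on Theorem 0").  For `N ≥ 1`, `Q, R ≥ 1/2`,
`Q₀ > 0`, `z ≥ 1`, `b ≥ B`, `|γ_q| ≤ τ(q)^B`, `β` sifted to level `z` ((A₄)), a bound `W₀ τ(d)^B` for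
the Barban–Davenport–Halberstam sums `∑_{q ≤ 2Q₀R} D(d; q)` (`d ≥ 1`; from Theorem 0 (a) in the
assembly) and bounds `S_b, S_{2b+2}, S_{3b+1}` (`S₁`) for `∑_{m ≤ 2Q} τ(m)^k/m` (`∑_{m≤2R} τ(m)/m`):
`|𝒳 − X| ≤ W₀ S_b S_{3b+1}/R + 4 log₂(2N)‖β‖²(2N/(zR) + Q₀) S_b² + 3N‖β‖² S₁ S_b S_{2b+2}/(RQ₀)`.
[cite: BombieriFriedlanderIwaniecActa1986, §7 (7.1)–(7.5) pp. 222–223] -/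
theorem abs_calX_sub_mainX_le_avg (a : ℤ) {N Q R Q₀ z B W0 Sb S2 S3 S1 : ℝ} (hN : 1 ≤ N)
    (hQ : 1 / 2 ≤ Q) (hR : 1 / 2 ≤ R) (hQ₀ : 0 < Q₀) (hz : 1 ≤ z) {b : ℕ} (hb : B ≤ b)
    {γ : ℕ → ℝ} (hγ : ∀ q, |γ q| ≤ (σ 0 q : ℝ) ^ B) (β : ℕ → ℝ)
    (hsift : IsSifted (dyadic N) z β) (hW0 : 0 ≤ W0)
    (h0a : ∀ d : ℕ, 1 ≤ d → ∑ q ∈ Icc 1 ⌊2 * Q₀ * R⌋₊, bdhD N β d q ≤ W0 * (σ 0 d : ℝ) ^ B)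
    (hSb : ∑ m ∈ Icc 1 ⌊2 * Q⌋₊, (σ 0 m : ℝ) ^ b / m ≤ Sb)
    (hS2 : ∑ m ∈ Icc 1 ⌊2 * Q⌋₊, (σ 0 m : ℝ) ^ (2 * b + 2) / m ≤ S2)
    (hS3 : ∑ m ∈ Icc 1 ⌊2 * Q⌋₊, (σ 0 m : ℝ) ^ (3 * b + 1) / m ≤ S3)
    (hS1 : ∑ m ∈ Icc 1 ⌊2 * R⌋₊, (σ 0 m : ℝ) / m ≤ S1) :
    |calX a N Q R Q₀ β γ - mainX a N Q R β γ| ≤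
      W0 * Sb * S3 / R +
        4 * ((Nat.log 2 ⌊2 * N⌋₊ : ℝ) * l2Sq N β * (2 * N / (z * R) + Q₀)) * Sb ^ 2 +
        3 * N * l2Sq N β * S1 * Sb * S2 / (R * Q₀) := by
  have hQ0 : 0 < Q := by linarith
  have hR0 : 0 < R := by linarith
  have hz0 : 0 < z := by linarith
  have hl := l2Sq_nonneg N β
  refine (abs_calX_sub_mainX_le a (by linarith) hQ0.le hR0.le Q₀ β γ hz hsift).trans ?_
  -- split every summand in three
  have hsplit := fun r (hr : r ∈ dyadic R) q₁ (hq₁ : q₁ ∈ dyadic Q) q₂ (hq₂ : q₂ ∈ dyadic Q) =>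
    xErr_le_three hN hQ₀.le hz0 hR0 hb hγ β (pos_of_mem_dyadic hR0.le hr)
      (pos_of_mem_dyadic hQ0.le hq₁) (pos_of_mem_dyadic hQ0.le hq₂) ((mem_dyadic hR0.le).1 hr).1.le
  refine (Finset.sum_le_sum fun r hr => Finset.sum_le_sum fun q₁ hq₁ =>
    Finset.sum_le_sum fun q₂ hq₂ => hsplit r hr q₁ hq₁ q₂ hq₂).trans ?_
  simp only [Finset.sum_add_distrib]
  have h1 := sum_piece1_le (N := N) (Q₀ := Q₀) hQ0.le hR0 hb β hW0 h0a hSb hS3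
  have h2 := sum_piece2_le (R := R) hQ hR
    (C := (Nat.log 2 ⌊2 * N⌋₊ : ℝ) * l2Sq N β * (2 * N / (z * R) + Q₀)) (by positivity) hSb
  have h3 := sum_piece3_le (by linarith : (0 : ℝ) ≤ N) hQ0.le hR0 hQ₀ β hSb hS2 hS1
  exact add_le_add (add_le_add h1 h2) h3

end BFI

end Literature.NumberTheory.Sieve
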